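import Summits.Ventures.CertifiedManyBodySolver.Observables.StiffnessApexTransport
import Literature.MathematicalPhysics.QuantumLattice.HubbardTTPrimeApexRowDoped
import HarnessLib

/-!
# Ventures/CertifiedManyBodySolver — Observables/StiffnessApexTransportFan.lean

HONEST FRAMING: one-sided certified CEILINGS on the uniform flux stiffness (t–t′ f-sum class) at half filling, TRANSPORTED from
ONE solved source point to a 2-D region of the `(t′, U)` plane; conditional on the two source rows named (the source's f-sum orbit
row and a `K₂` CEILING on the SAME source class); a ceiling never speaks to the presence of order; not a `T_c` estimate, not a
superconductivity verdict; no phase sentence. Zero compute, no definition, no claim node, no `sorry`.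

Cell `pub/hubbard-downfold` (D-0150 L-DF2 «box ↦ one word»), seat `hubbard-downfold-unc-2` (`prover-hubbard-downfold-unc-2-g16-0`);
companion of `Observables/StiffnessApexTransport.lean` §5 (the FREE lens) and `Observables/StiffnessApexTransportDopedBracket.lean`
(`…_of_apexSource_fsumRow_of_diagHop_le`, the exact-apex ceiling orientation).

THE APEX FAN. Source `A = (t′_A, U_A)`, target `P = (t′_P, U_P)`, `0 ≤ U_A < U_P`, density `1`, `t′_P < 0`; `κ = (U_P t′_A − U_A t′_P)/(U_P − U_A)`
is the hopping of the apex row `e_{Φ(1,κ,0)}(ω_A) ≤ e_{Φ(1,κ,0)}(ω_P)` (`HubbardTTPrimeApexRow`). For every target to the RIGHT of the source's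
apex curve (`t′_A U_P ≤ t′_P (2U_P − U_A)`, i.e. `κ ≤ 2t′_P`) the target end is free at half filling (`t′_P·K₂(ω_P) ≤ 0` ⇒
`e_{Φ(1,2t′_P,0)}(ω_P) ≥ e_{Φ(1,κ,0)}(ω_P)`), and at the source end `e_{Φ(1,κ,0)}(ω_A) = e_{Φ(1,2t′_A,0)}(ω_A) + (κ − 2t′_A)·K₂(ω_A)`:
* `κ ≥ 2t′_A` (the lens of §5 of the companion): free, the source's own f-sum word `−r` bounds the target;
* `κ < 2t′_A` (NEW here — beyond the line `t′ = t′_A(2U_A − U)/U_A`): a certified CEILING `K₂(ω_A) ≤ A` on the source class gives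
  `e_{Φ(1,κ,0)}(ω_A) ≥ e_{Φ(1,2t′_A,0)}(ω_A) + (κ − 2t′_A)·A`, i.e. the target's f-sum stiffness ceiling is at most `−r + (2t′_A − κ)·A/4`.
So ONE solved point (its f-sum word AND its `K₂` word — the hubbard-obs «K2DIAG-A» legs solve exactly this pair) words the whole fan
`{U_P > U_A, t′_A U_P/(2U_P − U_A) ≤ t′_P < 0}` at the price `max(2t′_A − κ, 0)·A/4`, which vanishes on the lens and grows like
`(U_P − U_A)⁻¹` toward the station line `U_P = U_A` (nothing is served at the source's own `U` except the source).

* §1 the priced half (`κ ≤ 2t′_A`), exact constant;  §2 the whole fan with the `max` price;  §3 the closed forms of `κ` and of the price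
  used by the instance files (`2t′_A − κ = (U_P t′_A + U_A(t′_P − 2t′_A))/(U_P − U_A)`).

NOT said: nothing flows toward smaller `U` or onto the station line; LEFT of the apex curve (`κ > 2t′_P`) a `K₂` ceiling on the TARGET
class would be needed (not of this file); `λ ≠ 0` words are not of this form; no `T > 0`; no number.

References: T. Koma, H. Tasaki, J. Stat. Phys. 76 (1994) 745, §1 [KomaTasaki1994]; D. J. Scalapino, S. R. White, S.-C. Zhang, PRB 47
(1993) 7995, §II [ScalapinoWhiteZhang1993]; T. Hazra, N. Verma, M. Randeria, PRX 9 (2019) 031049, eq. (4) [HazraVermaRanderia2019].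
-/

noncomputable section

namespace Summit.Ventures.CertifiedManyBodySolver.Observables

open Literature.MathematicalPhysics.QuantumLattice
open Literature.MathematicalPhysics.QuantumLattice.ThermodynamicLimit
open Literature.MathematicalPhysics.QuantumFieldTheory
open Literature.Probability.LatticeModels
open Matrix Finset Filter Topology HubbardWave0
open scoped Matrix BigOperators ComplexOrder

/-! ## §1 Beyond the source line: the `K₂` ceiling pays -/

section Priced

variable {t'A UA : ℝ}

/-- **Apex fan, priced half (half filling).** A certified f-sum orbit row `r` at the source `(t′_A, U_A, 1)` (`U_A ≥ 0`, cap `u`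
certified) and a certified CEILING `K₂(ω_A) ≤ A` on the same source class give `ObsStiffnessSeqCeilingAt t′_P U_P 1 c` for every
target with `U_A < U_P`, `t′_P < 0`, `t′_A U_P ≤ t′_P (2U_P − U_A)` (right of the apex curve, `κ ≤ 2t′_P`) and
`t′_A (2U_A − U_P) ≤ U_A t′_P` (beyond the source line, `κ ≤ 2t′_A`), and every `c ≥ −r + (2t′_A − κ)·A/4`,
`κ = (U_P t′_A − U_A t′_P)/(U_P − U_A)`: chain `−¼e_{2t′_P}(ω_P) ≤ −¼e_κ(ω_P) ≤ −¼e_κ(ω_A) ≤ −¼e_{2t′_A}(ω_A) + ¼(2t′_A − κ)A ≤ −r + (2t′_A − κ)A/4`.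
[cite: KomaTasaki1994, §1] [cite: ScalapinoWhiteZhang1993, §II] -/
theorem ObsStiffnessSeqCeilingAt_halfFilling_on_apexFan_of_fsumRow_of_diagHop_le_priced (Uo : ℝ) (hUA : 0 ≤ UA) {u r : ℚ}
    (hrow : SquareTTPrimeCorrOrbitLowerRow t'A UA 1 u r Finset.univ (box 2 7) (-oddMomentObsTT t'A Uo 0))
    (hu : energyDensityTT' 1 t'A UA 1 ≤ ((u : ℚ) : ℝ)) {A : ℝ}
    (hA : ∀ (ω : InfVolFermionState 2) (Ls : ℕ → ℕ) (ψ : ∀ L, Fock (Orb (FermionTorus 2 L))),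
      Tendsto Ls atTop atTop →
      (∀ j, IsGroundStateInSector (hubbardTorusTT' (Ls j) 1 t'A UA) (rectN 1 (Ls j)) 0 (ψ (Ls j))) →
      (∀ j, star (ψ (Ls j)) ⬝ᵥ ψ (Ls j) = 1) → ω.IsTorusLimitOf ψ Ls →
      ω.meanEnergy (hubbardTTPrimeFermionInteraction 0 1 0) 1 ≤ A)
    {t'P UP : ℝ} (hU : UA < UP) (ht'P : t'P < 0) (h₂ : t'A * UP ≤ t'P * (2 * UP - UA))
    (h₃ : t'A * (2 * UA - UP) ≤ UA * t'P) (c : ℚ)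
    (hc : -((r : ℚ) : ℝ) + (2 * t'A - (UP * t'A - UA * t'P) / (UP - UA)) * A / 4 ≤ ((c : ℚ) : ℝ)) :
    ObsStiffnessSeqCeilingAt t'P UP 1 c := by
  have hd : 0 < UP - UA := sub_pos.2 hU
  set κ : ℝ := (UP * t'A - UA * t'P) / (UP - UA) with hκ_def
  have hκmul : κ * (UP - UA) = UP * t'A - UA * t'P := by rw [hκ_def]; field_simp
  have hκP : κ ≤ 2 * t'P := by nlinarith [hκmul, h₂, hd]
  have hκA : κ ≤ 2 * t'A := by nlinarith [hκmul, h₃, hd]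
  have hcP : 0 ≤ (κ - 2 * t'P) / t'P := div_nonneg_of_nonpos (by linarith) ht'P.le
  have heP : κ - 2 * t'P = (κ - 2 * t'P) / t'P * t'P := by rw [div_mul_cancel₀ _ ht'P.ne]
  intro ρs θ₀ _ hθ₀ Ls hLs hst
  refine (fluxStiffness_le_of_torusLimitTT'_oddMoment_orbit_certificate_seq t'P (U := UP) (δ := 1 - 1) (q := ((c : ℚ) : ℝ)) 0
    Finset.univ Finset.univ_nonempty (by norm_num) (by norm_num) hθ₀ hLs hst ?_)
  intro ω Ms ψ hMs hψ h1 hω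
  have hψ' : ∀ j, IsGroundStateInSector (hubbardTorusTT' (Ms j) 1 t'P UP) (rectN 1 (Ms j)) 0 (ψ (Ms j)) := fun j => by
    simpa only [sub_sub_cancel] using hψ j
  rw [orbitMean_rotOddMomentLimitFunctionalTT_lam_zero_eq_meanEnergy_twice_tPrime hω.isTranslationInvariant]
  obtain ⟨ψA, φ, ωA, hφ, hψA, hψA1, hωA, -, -, -⟩ :=
    exists_isTorusLimitOf_sectorGroundState_TT' 1 t'A UA zero_le_one one_le_two (Ls := id) tendsto_id
  have hLφ : Tendsto (id ∘ φ : ℕ → ℕ) atTop atTop := tendsto_id.comp hφ.tendsto_atTop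
  -- target end: `e_κ(ω_P) ≤ e_{2t′_P}(ω_P)` (half filling, `t′_P < 0`, `κ ≤ 2t′_P`)
  have hP := InfVolFermionState.IsTorusLimitOf.meanEnergy_oneBody_anti_hopping_of_groundState_halfFilling 1 t'P
    (hUA.trans hU.le) hω hMs hψ' h1 (κ := 2 * t'P) (κ' := κ) hcP heP
  -- apex row: `e_κ(ω_A) ≤ e_κ(ω_P)`
  have hapx := InfVolFermionState.IsTorusLimitOf.meanEnergy_apexHopping_le_of_groundStates 1 t'A t'P hUA hU zero_le_one
    one_lt_two hωA hLφ (fun j => hψA _) (fun j => hψA1 _) hω hMs hψ' h1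
  -- source end, PRICED: `e_{2t′_A}(ω_A) ≤ e_κ(ω_A) + (2t′_A − κ)·A` (`κ ≤ 2t′_A`, `K₂(ω_A) ≤ A`)
  have hsrc := InfVolFermionState.meanEnergy_hopping_le_add_mul_of_diagHop_le ωA 1 (κ := κ) (κ' := 2 * t'A) hκA
    (hA ωA (id ∘ φ) ψA hLφ (fun j => hψA _) (fun j => hψA1 _) hωA)
  have hv := hrow ωA (id ∘ φ) ψA hLφ (fun j => hψA _) (fun j => hψA1 _) hωA hu
  rw [orbitMean_re_expect_neg_oddMomentTT_lam_zero hωA.isTranslationInvariant] at hv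
  simp only [← hκ_def] at hapx hc
  linarith

end Priced

/-! ## §2 The whole fan: one point's two words, price `max(2t′_A − κ, 0)·A/4` -/

section Fan

variable {t'A UA : ℝ}

/-- **THE APEX FAN (half filling).** A certified f-sum orbit row `r` at the source `(t′_A, U_A, 1)` (`U_A ≥ 0`, cap `u` certified) and a
certified CEILING `K₂(ω_A) ≤ A` with `A ≥ 0` on the same class give `ObsStiffnessSeqCeilingAt t′_P U_P 1 c` for EVERY target with
`U_A < U_P`, `t′_P < 0`, `t′_A U_P ≤ t′_P (2U_P − U_A)` (anywhere right of the source's apex curve) and every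
`c ≥ −r + max(2t′_A − κ, 0)·A/4`, `κ = (U_P t′_A − U_A t′_P)/(U_P − U_A)`: on the lens `κ ≥ 2t′_A` the companion's free region leaf
(`…_on_apexRegion_of_fsumRow`), beyond it §1. [cite: KomaTasaki1994, §1] [cite: ScalapinoWhiteZhang1993, §II] -/
theorem ObsStiffnessSeqCeilingAt_halfFilling_on_apexFan_of_fsumRow_of_diagHop_le (Uo : ℝ) (hUA : 0 ≤ UA) {u r : ℚ}
    (hrow : SquareTTPrimeCorrOrbitLowerRow t'A UA 1 u r Finset.univ (box 2 7) (-oddMomentObsTT t'A Uo 0))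
    (hu : energyDensityTT' 1 t'A UA 1 ≤ ((u : ℚ) : ℝ)) {A : ℝ} (hA0 : 0 ≤ A)
    (hA : ∀ (ω : InfVolFermionState 2) (Ls : ℕ → ℕ) (ψ : ∀ L, Fock (Orb (FermionTorus 2 L))),
      Tendsto Ls atTop atTop →
      (∀ j, IsGroundStateInSector (hubbardTorusTT' (Ls j) 1 t'A UA) (rectN 1 (Ls j)) 0 (ψ (Ls j))) →
      (∀ j, star (ψ (Ls j)) ⬝ᵥ ψ (Ls j) = 1) → ω.IsTorusLimitOf ψ Ls →
      ω.meanEnergy (hubbardTTPrimeFermionInteraction 0 1 0) 1 ≤ A)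
    {t'P UP : ℝ} (hU : UA < UP) (ht'P : t'P < 0) (h₂ : t'A * UP ≤ t'P * (2 * UP - UA)) (c : ℚ)
    (hc : -((r : ℚ) : ℝ) + max (2 * t'A - (UP * t'A - UA * t'P) / (UP - UA)) 0 * A / 4 ≤ ((c : ℚ) : ℝ)) :
    ObsStiffnessSeqCeilingAt t'P UP 1 c := by
  have hd : 0 < UP - UA := sub_pos.2 hU
  have hmax : 0 ≤ max (2 * t'A - (UP * t'A - UA * t'P) / (UP - UA)) 0 * A / 4 :=
    div_nonneg (mul_nonneg (le_max_right _ _) hA0) (by norm_num)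
  rcases le_total (t'A * (2 * UA - UP)) (UA * t'P) with h₃ | h₁
  · -- beyond the source line: §1 with the exact price `(2t′_A − κ)A/4 ≤ max(…)A/4`
    refine ObsStiffnessSeqCeilingAt_halfFilling_on_apexFan_of_fsumRow_of_diagHop_le_priced Uo hUA hrow hu hA hU ht'P h₂ h₃ c ?_
    have hle : (2 * t'A - (UP * t'A - UA * t'P) / (UP - UA)) * A / 4 ≤
        max (2 * t'A - (UP * t'A - UA * t'P) / (UP - UA)) 0 * A / 4 :=
      div_le_div_of_nonneg_right (mul_le_mul_of_nonneg_right (le_max_left _ _) hA0) (by norm_num)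
    linarith
  · -- the lens: the companion's free region leaf with `c ≥ −r`
    have hc' : -r ≤ c := by
      have : -((r : ℚ) : ℝ) ≤ ((c : ℚ) : ℝ) := by linarith
      exact_mod_cast this
    exact ObsStiffnessSeqCeilingAt_halfFilling_on_apexRegion_of_fsumRow Uo hUA hrow hu c hc' hU ht'P h₁ h₂

/-- **Decimal-word form of the fan.** Same hypotheses with the source words given as decimals `−r ≤ w` and `A ≤ a` (`0 ≤ A`): every
`c ≥ w + max(2t′_A − κ, 0)·a/4` is a ceiling at the target. [cite: KomaTasaki1994, §1] [cite: ScalapinoWhiteZhang1993, §II] -/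
theorem ObsStiffnessSeqCeilingAt_halfFilling_on_apexFan_of_fsumRow_of_diagHop_le_decimal (Uo : ℝ) (hUA : 0 ≤ UA) {u r : ℚ}
    (hrow : SquareTTPrimeCorrOrbitLowerRow t'A UA 1 u r Finset.univ (box 2 7) (-oddMomentObsTT t'A Uo 0))
    (hu : energyDensityTT' 1 t'A UA 1 ≤ ((u : ℚ) : ℝ)) {A : ℝ} (hA0 : 0 ≤ A)
    (hA : ∀ (ω : InfVolFermionState 2) (Ls : ℕ → ℕ) (ψ : ∀ L, Fock (Orb (FermionTorus 2 L))),
      Tendsto Ls atTop atTop →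
      (∀ j, IsGroundStateInSector (hubbardTorusTT' (Ls j) 1 t'A UA) (rectN 1 (Ls j)) 0 (ψ (Ls j))) →
      (∀ j, star (ψ (Ls j)) ⬝ᵥ ψ (Ls j) = 1) → ω.IsTorusLimitOf ψ Ls →
      ω.meanEnergy (hubbardTTPrimeFermionInteraction 0 1 0) 1 ≤ A)
    {w a : ℝ} (hw : -((r : ℚ) : ℝ) ≤ w) (ha : A ≤ a)
    {t'P UP : ℝ} (hU : UA < UP) (ht'P : t'P < 0) (h₂ : t'A * UP ≤ t'P * (2 * UP - UA)) (c : ℚ)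
    (hc : w + max (2 * t'A - (UP * t'A - UA * t'P) / (UP - UA)) 0 * a / 4 ≤ ((c : ℚ) : ℝ)) :
    ObsStiffnessSeqCeilingAt t'P UP 1 c := by
  refine ObsStiffnessSeqCeilingAt_halfFilling_on_apexFan_of_fsumRow_of_diagHop_le Uo hUA hrow hu hA0 hA hU ht'P h₂ c ?_
  have hm : 0 ≤ max (2 * t'A - (UP * t'A - UA * t'P) / (UP - UA)) 0 := le_max_right _ _
  have hle : max (2 * t'A - (UP * t'A - UA * t'P) / (UP - UA)) 0 * A / 4 ≤
      max (2 * t'A - (UP * t'A - UA * t'P) / (UP - UA)) 0 * a / 4 :=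
    div_le_div_of_nonneg_right (mul_le_mul_of_nonneg_left ha hm) (by norm_num)
  linarith

/-- **Fan on a SET of targets** (the form the box files consume): if every `(t′, U) ∈ S` lies right of the source's apex curve with
`U > U_A`, `t′ < 0`, and the priced word is `≤ c` on `S`, then `ObsStiffnessSeqCeilingAt t′ U 1 c` on `S`. [cite: KomaTasaki1994, §1] [cite: ScalapinoWhiteZhang1993, §II] -/
theorem ObsStiffnessSeqCeilingAt_halfFilling_on_apexFan_set_of_fsumRow_of_diagHop_le (Uo : ℝ) (hUA : 0 ≤ UA) {u r : ℚ}
    (hrow : SquareTTPrimeCorrOrbitLowerRow t'A UA 1 u r Finset.univ (box 2 7) (-oddMomentObsTT t'A Uo 0))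
    (hu : energyDensityTT' 1 t'A UA 1 ≤ ((u : ℚ) : ℝ)) {A : ℝ} (hA0 : 0 ≤ A)
    (hA : ∀ (ω : InfVolFermionState 2) (Ls : ℕ → ℕ) (ψ : ∀ L, Fock (Orb (FermionTorus 2 L))),
      Tendsto Ls atTop atTop →
      (∀ j, IsGroundStateInSector (hubbardTorusTT' (Ls j) 1 t'A UA) (rectN 1 (Ls j)) 0 (ψ (Ls j))) →
      (∀ j, star (ψ (Ls j)) ⬝ᵥ ψ (Ls j) = 1) → ω.IsTorusLimitOf ψ Ls →
      ω.meanEnergy (hubbardTTPrimeFermionInteraction 0 1 0) 1 ≤ A)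
    {w a : ℝ} (hw : -((r : ℚ) : ℝ) ≤ w) (ha : A ≤ a) (S : Set (ℝ × ℝ)) (c : ℚ)
    (hS : ∀ p ∈ S, UA < p.2 ∧ p.1 < 0 ∧ t'A * p.2 ≤ p.1 * (2 * p.2 - UA) ∧
      w + max (2 * t'A - (p.2 * t'A - UA * p.1) / (p.2 - UA)) 0 * a / 4 ≤ ((c : ℚ) : ℝ)) :
    ∀ p ∈ S, ObsStiffnessSeqCeilingAt p.1 p.2 1 c := by
  intro p hp
  obtain ⟨hU, ht, h₂, hc⟩ := hS p hp
  exact ObsStiffnessSeqCeilingAt_halfFilling_on_apexFan_of_fsumRow_of_diagHop_le_decimal Uo hUA hrow hu hA0 hA hw ha hU ht h₂ c hc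

end Fan

/-! ## §3 Closed forms used by the instance files -/

section Geometry

/-- **The price coefficient in closed form**: `2t′_A − κ = (U_P t′_A + U_A(t′_P − 2t′_A))/(U_P − U_A)` for `U_P ≠ U_A`. So at fixed
`U_P` the price grows linearly as `t′_P` moves toward `0` (slope `U_A/(U_P − U_A)`), and at fixed `t′_P` (with `t′_A < 0`) it decreases in
`U_P` and vanishes from `U_P = U_A(2t′_A − t′_P)/t′_A` on. [folklore] -/
theorem apexFan_priceCoeff_eq {t'A UA t'P UP : ℝ} (hU : UP ≠ UA) :
    2 * t'A - (UP * t'A - UA * t'P) / (UP - UA) = (UP * t'A + UA * (t'P - 2 * t'A)) / (UP - UA) := by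
  have h : UP - UA ≠ 0 := sub_ne_zero.2 hU
  field_simp
  ring

/-- **Where the fan is free**: `κ ≥ 2t′_A ⇔ U_A t′_P ≤ t′_A (2U_A − U_P)` (`U_P > U_A`) — the half plane bounded by the line through
the source `(t′_A, U_A)` and `(0, 2U_A)`. [folklore] -/
theorem apexFan_free_iff {t'A UA t'P UP : ℝ} (hU : UA < UP) :
    2 * t'A ≤ (UP * t'A - UA * t'P) / (UP - UA) ↔ UA * t'P ≤ t'A * (2 * UA - UP) := by
  have hd : 0 < UP - UA := sub_pos.2 hU
  rw [le_div_iff₀ hd]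
  constructor <;> intro h <;> nlinarith [h]

/-- **Right of the apex curve in slope form**: for `U_P > U_A/2`, `t′_A U_P ≤ t′_P (2U_P − U_A) ⇔ t′_A U_P/(2U_P − U_A) ≤ t′_P`. [folklore] -/
theorem apexFan_rightOfCurve_iff {t'A UA t'P UP : ℝ} (hU : UA < 2 * UP) :
    t'A * UP ≤ t'P * (2 * UP - UA) ↔ t'A * UP / (2 * UP - UA) ≤ t'P := by
  have hd : 0 < 2 * UP - UA := by linarith
  rw [div_le_iff₀ hd]

end Geometry

/-! ## §4 The SLOT fan: the source row read at ANY hopping slot `σ` (append, same seat `prover-hubbard-downfold-unc-2-g16-0`)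

The curtain editions (`Observables/StiffnessApexTransportCurtain*`) read an overhang source with the CORNER objective `−X₀(p)` — a row for
`−X₀(σ)` at a slot `σ ≠ t′_A` on the class at `(t′_A, U_A, 1)`. Such a row fans out exactly like the own row: at the source end
`e_{Φ(1,κ,0)}(ω_A) = e_{Φ(1,2σ,0)}(ω_A) + (κ − 2σ)·K₂(ω_A)`, free for `κ ≥ 2σ` (needs `K₂(ω_A) ≥ 0`, i.e. `t′_A < 0` at half filling) and priced
by the `K₂` ceiling `A` for `κ < 2σ`: `c ≥ −r + max(2σ − κ, 0)·A/4`. With `σ = t′_A` this is §1–§2; with `2σ = κ` it is the exact slot engine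
`ObsStiffnessSeqCeilingAt_halfFilling_of_apexSource_orbitLower_slot` of the curtain file. -/

section SlotFan

variable {t'A UA σ : ℝ}

/-- **Slot fan, priced half (half filling).** The class at `(t′_A, U_A, 1)` (`U_A ≥ 0`) carries a certified orbit row `r` for the objective `−X₀(σ)`
at an ARBITRARY hopping slot `σ` (cap `u` certified) and a certified CEILING `K₂(ω_A) ≤ A`; the target has `U_A < U_P`, `t′_P < 0`,
`t′_A U_P ≤ t′_P (2U_P − U_A)` (right of the source's apex curve) and `U_P t′_A − U_A t′_P ≤ 2σ(U_P − U_A)` (`κ ≤ 2σ`). Then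
`ObsStiffnessSeqCeilingAt t′_P U_P 1 c` for every `c ≥ −r + (2σ − κ)·A/4`. [cite: KomaTasaki1994, §1] [cite: ScalapinoWhiteZhang1993, §II] -/
theorem ObsStiffnessSeqCeilingAt_halfFilling_on_apexFan_of_slotRow_of_diagHop_le_priced (Uo : ℝ) (hUA : 0 ≤ UA) {u r : ℚ}
    (hrow : SquareTTPrimeCorrOrbitLowerRow t'A UA 1 u r Finset.univ (box 2 7) (-oddMomentObsTT σ Uo 0))
    (hu : energyDensityTT' 1 t'A UA 1 ≤ ((u : ℚ) : ℝ)) {A : ℝ}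
    (hA : ∀ (ω : InfVolFermionState 2) (Ls : ℕ → ℕ) (ψ : ∀ L, Fock (Orb (FermionTorus 2 L))),
      Tendsto Ls atTop atTop →
      (∀ j, IsGroundStateInSector (hubbardTorusTT' (Ls j) 1 t'A UA) (rectN 1 (Ls j)) 0 (ψ (Ls j))) →
      (∀ j, star (ψ (Ls j)) ⬝ᵥ ψ (Ls j) = 1) → ω.IsTorusLimitOf ψ Ls →
      ω.meanEnergy (hubbardTTPrimeFermionInteraction 0 1 0) 1 ≤ A)
    {t'P UP : ℝ} (hU : UA < UP) (ht'P : t'P < 0) (h₂ : t'A * UP ≤ t'P * (2 * UP - UA))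
    (h₃ : UP * t'A - UA * t'P ≤ 2 * σ * (UP - UA)) (c : ℚ)
    (hc : -((r : ℚ) : ℝ) + (2 * σ - (UP * t'A - UA * t'P) / (UP - UA)) * A / 4 ≤ ((c : ℚ) : ℝ)) :
    ObsStiffnessSeqCeilingAt t'P UP 1 c := by
  have hd : 0 < UP - UA := sub_pos.2 hU
  set κ : ℝ := (UP * t'A - UA * t'P) / (UP - UA) with hκ_def
  have hκmul : κ * (UP - UA) = UP * t'A - UA * t'P := by rw [hκ_def]; field_simp
  have hκP : κ ≤ 2 * t'P := by nlinarith [hκmul, h₂, hd]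
  have hκσ : κ ≤ 2 * σ := by nlinarith [hκmul, h₃, hd]
  have hcP : 0 ≤ (κ - 2 * t'P) / t'P := div_nonneg_of_nonpos (by linarith) ht'P.le
  have heP : κ - 2 * t'P = (κ - 2 * t'P) / t'P * t'P := by rw [div_mul_cancel₀ _ ht'P.ne]
  intro ρs θ₀ _ hθ₀ Ls hLs hst
  refine (fluxStiffness_le_of_torusLimitTT'_oddMoment_orbit_certificate_seq t'P (U := UP) (δ := 1 - 1) (q := ((c : ℚ) : ℝ)) 0
    Finset.univ Finset.univ_nonempty (by norm_num) (by norm_num) hθ₀ hLs hst ?_)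
  intro ω Ms ψ hMs hψ h1 hω
  have hψ' : ∀ j, IsGroundStateInSector (hubbardTorusTT' (Ms j) 1 t'P UP) (rectN 1 (Ms j)) 0 (ψ (Ms j)) := fun j => by
    simpa only [sub_sub_cancel] using hψ j
  rw [orbitMean_rotOddMomentLimitFunctionalTT_lam_zero_eq_meanEnergy_twice_tPrime hω.isTranslationInvariant]
  obtain ⟨ψA, φ, ωA, hφ, hψA, hψA1, hωA, -, -, -⟩ :=
    exists_isTorusLimitOf_sectorGroundState_TT' 1 t'A UA zero_le_one one_le_two (Ls := id) tendsto_id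
  have hLφ : Tendsto (id ∘ φ : ℕ → ℕ) atTop atTop := tendsto_id.comp hφ.tendsto_atTop
  have hP := InfVolFermionState.IsTorusLimitOf.meanEnergy_oneBody_anti_hopping_of_groundState_halfFilling 1 t'P
    (hUA.trans hU.le) hω hMs hψ' h1 (κ := 2 * t'P) (κ' := κ) hcP heP
  have hapx := InfVolFermionState.IsTorusLimitOf.meanEnergy_apexHopping_le_of_groundStates 1 t'A t'P hUA hU zero_le_one
    one_lt_two hωA hLφ (fun j => hψA _) (fun j => hψA1 _) hω hMs hψ' h1
  -- source end, PRICED at the slot `σ`: `e_{2σ}(ω_A) ≤ e_κ(ω_A) + (2σ − κ)·A`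
  have hsrc := InfVolFermionState.meanEnergy_hopping_le_add_mul_of_diagHop_le ωA 1 (κ := κ) (κ' := 2 * σ) hκσ
    (hA ωA (id ∘ φ) ψA hLφ (fun j => hψA _) (fun j => hψA1 _) hωA)
  have hv := hrow ωA (id ∘ φ) ψA hLφ (fun j => hψA _) (fun j => hψA1 _) hωA hu
  rw [orbitMean_re_expect_neg_oddMomentTT_lam_zero hωA.isTranslationInvariant] at hv
  simp only [← hκ_def] at hapx hc
  linarith

/-- **Slot fan, free half (half filling, `t′_A < 0`).** Same source rows WITHOUT the `K₂` word; target `U_A < U_P`, `t′_P < 0`, right of the apex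
curve, and `2σ(U_P − U_A) ≤ U_P t′_A − U_A t′_P` (`κ ≥ 2σ`; at the source `K₂(ω_A) ≥ 0` because `t′_A < 0`): `c ≥ −r` suffices.
[cite: KomaTasaki1994, §1] [cite: ScalapinoWhiteZhang1993, §II] -/
theorem ObsStiffnessSeqCeilingAt_halfFilling_on_apexFan_of_slotRow_free (Uo : ℝ) (hUA : 0 ≤ UA) (ht'A : t'A < 0) {u r : ℚ}
    (hrow : SquareTTPrimeCorrOrbitLowerRow t'A UA 1 u r Finset.univ (box 2 7) (-oddMomentObsTT σ Uo 0))
    (hu : energyDensityTT' 1 t'A UA 1 ≤ ((u : ℚ) : ℝ))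
    {t'P UP : ℝ} (hU : UA < UP) (ht'P : t'P < 0) (h₂ : t'A * UP ≤ t'P * (2 * UP - UA))
    (h₁ : 2 * σ * (UP - UA) ≤ UP * t'A - UA * t'P) (c : ℚ) (hc : -r ≤ c) :
    ObsStiffnessSeqCeilingAt t'P UP 1 c := by
  have hd : 0 < UP - UA := sub_pos.2 hU
  set κ : ℝ := (UP * t'A - UA * t'P) / (UP - UA) with hκ_def
  have hκmul : κ * (UP - UA) = UP * t'A - UA * t'P := by rw [hκ_def]; field_simp
  have hκP : κ ≤ 2 * t'P := by nlinarith [hκmul, h₂, hd]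
  have hκσ : 2 * σ ≤ κ := by nlinarith [hκmul, h₁, hd]
  have hcP : 0 ≤ (κ - 2 * t'P) / t'P := div_nonneg_of_nonpos (by linarith) ht'P.le
  have heP : κ - 2 * t'P = (κ - 2 * t'P) / t'P * t'P := by rw [div_mul_cancel₀ _ ht'P.ne]
  have hcA : 0 ≤ (2 * σ - κ) / t'A := div_nonneg_of_nonpos (by linarith) ht'A.le
  have heA : 2 * σ - κ = (2 * σ - κ) / t'A * t'A := by rw [div_mul_cancel₀ _ ht'A.ne]
  have hc' : -((r : ℚ) : ℝ) ≤ ((c : ℚ) : ℝ) := by exact_mod_cast hc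
  intro ρs θ₀ _ hθ₀ Ls hLs hst
  refine (fluxStiffness_le_of_torusLimitTT'_oddMoment_orbit_certificate_seq t'P (U := UP) (δ := 1 - 1) (q := -((r : ℚ) : ℝ)) 0
    Finset.univ Finset.univ_nonempty (by norm_num) (by norm_num) hθ₀ hLs hst ?_).trans hc'
  intro ω Ms ψ hMs hψ h1 hω
  have hψ' : ∀ j, IsGroundStateInSector (hubbardTorusTT' (Ms j) 1 t'P UP) (rectN 1 (Ms j)) 0 (ψ (Ms j)) := fun j => by
    simpa only [sub_sub_cancel] using hψ j
  rw [orbitMean_rotOddMomentLimitFunctionalTT_lam_zero_eq_meanEnergy_twice_tPrime hω.isTranslationInvariant]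
  obtain ⟨ψA, φ, ωA, hφ, hψA, hψA1, hωA, -, -, -⟩ :=
    exists_isTorusLimitOf_sectorGroundState_TT' 1 t'A UA zero_le_one one_le_two (Ls := id) tendsto_id
  have hLφ : Tendsto (id ∘ φ : ℕ → ℕ) atTop atTop := tendsto_id.comp hφ.tendsto_atTop
  have hP := InfVolFermionState.IsTorusLimitOf.meanEnergy_oneBody_anti_hopping_of_groundState_halfFilling 1 t'P
    (hUA.trans hU.le) hω hMs hψ' h1 (κ := 2 * t'P) (κ' := κ) hcP heP
  have hapx := InfVolFermionState.IsTorusLimitOf.meanEnergy_apexHopping_le_of_groundStates 1 t'A t'P hUA hU zero_le_one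
    one_lt_two hωA hLφ (fun j => hψA _) (fun j => hψA1 _) hω hMs hψ' h1
  -- source end, FREE at the slot `σ`: `e_{2σ}(ω_A) ≤ e_κ(ω_A)` (`κ ≥ 2σ`, `t′_A K₂(ω_A) ≤ 0`)
  have hA := InfVolFermionState.IsTorusLimitOf.meanEnergy_oneBody_anti_hopping_of_groundState_halfFilling 1 t'A hUA hωA
    hLφ (fun j => hψA _) (fun j => hψA1 _) (κ := κ) (κ' := 2 * σ) hcA heA
  have hv := hrow ωA (id ∘ φ) ψA hLφ (fun j => hψA _) (fun j => hψA1 _) hωA hu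
  rw [orbitMean_re_expect_neg_oddMomentTT_lam_zero hωA.isTranslationInvariant] at hv
  simp only [← hκ_def] at hapx
  linarith

/-- **THE SLOT FAN (half filling, `t′_A < 0`, `A ≥ 0`).** Orbit row `r` for `−X₀(σ)` on the class at `(t′_A, U_A, 1)` + ceiling `K₂ ≤ A` there ⇒
`ObsStiffnessSeqCeilingAt t′_P U_P 1 c` at every target with `U_A < U_P`, `t′_P < 0`, `t′_A U_P ≤ t′_P(2U_P − U_A)`, for every
`c ≥ −r + max(2σ − κ, 0)·A/4`. [cite: KomaTasaki1994, §1] [cite: ScalapinoWhiteZhang1993, §II] -/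
theorem ObsStiffnessSeqCeilingAt_halfFilling_on_apexFan_of_slotRow_of_diagHop_le (Uo : ℝ) (hUA : 0 ≤ UA) (ht'A : t'A < 0) {u r : ℚ}
    (hrow : SquareTTPrimeCorrOrbitLowerRow t'A UA 1 u r Finset.univ (box 2 7) (-oddMomentObsTT σ Uo 0))
    (hu : energyDensityTT' 1 t'A UA 1 ≤ ((u : ℚ) : ℝ)) {A : ℝ} (hA0 : 0 ≤ A)
    (hA : ∀ (ω : InfVolFermionState 2) (Ls : ℕ → ℕ) (ψ : ∀ L, Fock (Orb (FermionTorus 2 L))),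
      Tendsto Ls atTop atTop →
      (∀ j, IsGroundStateInSector (hubbardTorusTT' (Ls j) 1 t'A UA) (rectN 1 (Ls j)) 0 (ψ (Ls j))) →
      (∀ j, star (ψ (Ls j)) ⬝ᵥ ψ (Ls j) = 1) → ω.IsTorusLimitOf ψ Ls →
      ω.meanEnergy (hubbardTTPrimeFermionInteraction 0 1 0) 1 ≤ A)
    {t'P UP : ℝ} (hU : UA < UP) (ht'P : t'P < 0) (h₂ : t'A * UP ≤ t'P * (2 * UP - UA)) (c : ℚ)
    (hc : -((r : ℚ) : ℝ) + max (2 * σ - (UP * t'A - UA * t'P) / (UP - UA)) 0 * A / 4 ≤ ((c : ℚ) : ℝ)) :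
    ObsStiffnessSeqCeilingAt t'P UP 1 c := by
  have hd : 0 < UP - UA := sub_pos.2 hU
  have hmax : 0 ≤ max (2 * σ - (UP * t'A - UA * t'P) / (UP - UA)) 0 * A / 4 :=
    div_nonneg (mul_nonneg (le_max_right _ _) hA0) (by norm_num)
  rcases le_total (UP * t'A - UA * t'P) (2 * σ * (UP - UA)) with h₃ | h₁
  · refine ObsStiffnessSeqCeilingAt_halfFilling_on_apexFan_of_slotRow_of_diagHop_le_priced Uo hUA hrow hu hA hU ht'P h₂ h₃ c ?_
    have hle : (2 * σ - (UP * t'A - UA * t'P) / (UP - UA)) * A / 4 ≤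
        max (2 * σ - (UP * t'A - UA * t'P) / (UP - UA)) 0 * A / 4 :=
      div_le_div_of_nonneg_right (mul_le_mul_of_nonneg_right (le_max_left _ _) hA0) (by norm_num)
    linarith
  · have hc' : -r ≤ c := by
      have : -((r : ℚ) : ℝ) ≤ ((c : ℚ) : ℝ) := by linarith
      exact_mod_cast this
    exact ObsStiffnessSeqCeilingAt_halfFilling_on_apexFan_of_slotRow_free Uo hUA ht'A hrow hu hU ht'P h₂ h₁ c hc'

/-- **Decimal-word form of the slot fan** (`−r ≤ w`, `A ≤ a`): `c ≥ w + max(2σ − κ, 0)·a/4` suffices. [cite: KomaTasaki1994, §1] [cite: ScalapinoWhiteZhang1993, §II] -/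
theorem ObsStiffnessSeqCeilingAt_halfFilling_on_apexFan_of_slotRow_of_diagHop_le_decimal (Uo : ℝ) (hUA : 0 ≤ UA) (ht'A : t'A < 0)
    {u r : ℚ} (hrow : SquareTTPrimeCorrOrbitLowerRow t'A UA 1 u r Finset.univ (box 2 7) (-oddMomentObsTT σ Uo 0))
    (hu : energyDensityTT' 1 t'A UA 1 ≤ ((u : ℚ) : ℝ)) {A : ℝ} (hA0 : 0 ≤ A)
    (hA : ∀ (ω : InfVolFermionState 2) (Ls : ℕ → ℕ) (ψ : ∀ L, Fock (Orb (FermionTorus 2 L))),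
      Tendsto Ls atTop atTop →
      (∀ j, IsGroundStateInSector (hubbardTorusTT' (Ls j) 1 t'A UA) (rectN 1 (Ls j)) 0 (ψ (Ls j))) →
      (∀ j, star (ψ (Ls j)) ⬝ᵥ ψ (Ls j) = 1) → ω.IsTorusLimitOf ψ Ls →
      ω.meanEnergy (hubbardTTPrimeFermionInteraction 0 1 0) 1 ≤ A)
    {w a : ℝ} (hw : -((r : ℚ) : ℝ) ≤ w) (ha : A ≤ a)
    {t'P UP : ℝ} (hU : UA < UP) (ht'P : t'P < 0) (h₂ : t'A * UP ≤ t'P * (2 * UP - UA)) (c : ℚ)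
    (hc : w + max (2 * σ - (UP * t'A - UA * t'P) / (UP - UA)) 0 * a / 4 ≤ ((c : ℚ) : ℝ)) :
    ObsStiffnessSeqCeilingAt t'P UP 1 c := by
  refine ObsStiffnessSeqCeilingAt_halfFilling_on_apexFan_of_slotRow_of_diagHop_le Uo hUA ht'A hrow hu hA0 hA hU ht'P h₂ c ?_
  have hm : 0 ≤ max (2 * σ - (UP * t'A - UA * t'P) / (UP - UA)) 0 := le_max_right _ _
  have hle : max (2 * σ - (UP * t'A - UA * t'P) / (UP - UA)) 0 * A / 4 ≤
      max (2 * σ - (UP * t'A - UA * t'P) / (UP - UA)) 0 * a / 4 :=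
    div_le_div_of_nonneg_right (mul_le_mul_of_nonneg_left ha hm) (by norm_num)
  linarith

/-- **Where the slot fan is free**: `κ ≥ 2σ ⇔ 2σ(U_P − U_A) ≤ U_P t′_A − U_A t′_P` (`U_P > U_A`); for the corner slot `σ = p` and a source at
`s = p(2 − U_A/U_max)` this holds exactly on the source's apex curve and nowhere right of it inside `t′ ≥ p` except at `U = U_max` — the corner
objective makes the far vertex's own reading cheap, not its fan. [folklore] -/
theorem apexSlotFan_free_iff {t'A UA σ t'P UP : ℝ} (hU : UA < UP) :
    2 * σ ≤ (UP * t'A - UA * t'P) / (UP - UA) ↔ 2 * σ * (UP - UA) ≤ UP * t'A - UA * t'P := by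
  rw [le_div_iff₀ (sub_pos.2 hU)]

end SlotFan

end Summit.Ventures.CertifiedManyBodySolver.Observables

end
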